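import Summits.ABC.ABC.Theorems.IsogenyGlueCongruenceEllipticGluingPrimeBoundStubCaseB
import Summits.ABC.ABC.Theorems.IsogenyGlueCongruenceEllipticGluingPrimeBoundStubGeomIsotypicSplitting
import Summits.ABC.ABC.Theorems.IsogenyGlueCongruenceEllipticGluingPrimeBoundStubIsotypicDichotomy
import Summits.ABC.ABC.Theorems.EllipticGluingPrimeBound.Negative.LoadBearing
import HarnessLib

/-!
# Rational-part reduction (stub `stub_rationalPartReduction`, line `Sketch`) — helper file 1/2

Helpers for stub `stub_rationalPartReduction` ((R), rational-part reduction) of line `Sketch`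
(isotypic–Minkowski reduction) of crux U
`Summit.ABC.ABC.Theses.IsogenyGlueCongruence.EllipticGluingPrimeBound` (stmt-ABC-13919); the stub
itself is proved in the companion file `…StubRationalPartReduction` (file 2/2).

* `exists_rational_quasiRetraction` — **Poincaré reducibility over `ℚ`, quasi-retraction form**: a
  closed-immersion homomorphism `i : B₁ ↪ B` over `ℚ` has `q : B → B₁` with `i ≫ q = M • 𝟙`,
  `M ≥ 1` (Poincaré over `ℚ̄`, `AbelianVariety.poincare_complete_reducibility`, a quasi-inverse,
  and the Galois averaging / descent of ONE endomorphism of `(B₁ ⊞ B)_ℚ̄`, exactly as in the landed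
  `exists_descended_quasiProjector`: `finite_range_toRingHom_galois`,
  `exists_baseChange_eq_of_forall_galConj_eq`).
* `exists_isIsogeny_desc_of_quasiRetraction` — the complement `B₂ = im (M − q ≫ i)`, with
  `(i, j) : B₁ ⊞ B₂ → B` an isogeny (as in the landed `stub_geomIsotypicSplitting`).
* `exists_biprodPower` — `E^r` (`r ≥ 1`) as an iterated binary biproduct, packaged by projections,
  inclusions and the biproduct identities (no definition is introduced).
* `geomTorsion_le_of_stable_of_irreducible` — irreducibility of `W[ℓ]` transported to `E[ℓ]` along
  an equivariant `e : E(ℚ̄) ≃+ W(ℚ̄)` (the `AddSubgroup` form consumed by `stub_caseB`).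
* `exists_smul_line_le_of_stable'` — a non-zero stable subgroup of `V^r`, `V` irreducible with
  scalar commutant, contains a line `{(n_j • P)_j}` with some `n_i` acting as the identity.

Everything is proved (axioms `propext`, `Classical.choice`, `Quot.sound`); no `def`, no named fact.
References: D. Mumford, *Abelian Varieties* (1970), §19, Thm. 1 and Remark p. 169; J. S. Milne,
*Abelian Varieties* (Cornell–Silverman 1986), Prop. 12.1 and §16.
-/

noncomputable section

-- `Summit.<Summit>.<Problem>` is the mandated summit-side namespace (CONVENTIONS §2); for the
-- single-conjunct summit `ABC` the two coincide, so the duplicate `ABC.ABC` is deliberate.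
set_option linter.dupNamespace false

namespace Summit.ABC.ABC.Theorems.IsotypicMinkowski

open CategoryTheory CategoryTheory.Limits AlgebraicGeometry
open Literature.AlgebraicGeometry.Motives
open Summit.ABC.ABC.Theses.IsogenyGlueCongruence
open Literature.AlgebraicGeometry.Motives.AbelianVariety

/-- **A closed-immersion homomorphism `i : B₁ ↪ B` over `ℚ` has a rational quasi-retraction**
`q : B → B₁`, `i ≫ q = M • 𝟙`, `M ≥ 1`. Over `ℚ̄`, Poincaré's theorem and a quasi-inverse `ψ` of
`(i_ℚ̄, j') : B₁,ℚ̄ ⊞ Z → B_ℚ̄` give `q' = ψ ≫ fst` with `i_ℚ̄ ≫ q' = m • 𝟙`; in `End((B₁ ⊞ B)_ℚ̄)`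
the corner `Y = snd ≫ q' ≫ inl` has `I ≫ Y = m • ε` for the Galois-fixed `I = (fst ≫ i ≫ inr)_ℚ̄`,
`ε = (fst ≫ inl)_ℚ̄`, hence so does every conjugate of `Y`; the sum `U` of the conjugates over the
finite image `G` of `Gal(ℚ̄/ℚ)` descends to `u ∈ End_ℚ(B₁ ⊞ B)`, and `q = inr ≫ u ≫ fst` has
`i ≫ q = (|G| m) • 𝟙` (checked over `ℚ̄`, `Hom.baseChange_injective`). (Mumford §19, Thm. 1.) -/
theorem exists_rational_quasiRetraction {B₁ B : AbelianVariety.{0} ℚ} (i : B₁ ⟶ B)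
    [IsClosedImmersion (AbelianVariety.Hom.toSchemeHom i)] :
    ∃ (q : B ⟶ B₁) (M : ℕ), 0 < M ∧ i ≫ q = M • 𝟙 B₁ := by
  haveI := normal_algebraicClosure_rat
  set iL := Hom.baseChange (AlgebraicClosure ℚ) i with hiL
  haveI : IsClosedImmersion (Hom.toSchemeHom iL) :=
    isClosedImmersion_baseChange (AlgebraicClosure ℚ) i
  obtain ⟨Z, j', -, hφ⟩ := poincare_complete_reducibility iL
  obtain ⟨ψ, m, hm, hφψ, -⟩ := IsIsogeny.exists_nsmul_inverse_holds hφ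
  set q' : B.baseChange (AlgebraicClosure ℚ) ⟶ B₁.baseChange (AlgebraicClosure ℚ) :=
    ψ ≫ biprod.fst with hq'
  have hq'i : iL ≫ q' = m • 𝟙 _ := by
    calc iL ≫ q' = (biprod.inl ≫ biprod.desc iL j') ≫ ψ ≫ biprod.fst := by
          rw [biprod.inl_desc]
      _ = m • 𝟙 _ := by
          rw [Category.assoc, reassoc_of% hφψ, Preadditive.nsmul_comp, Category.id_comp,
            Preadditive.comp_nsmul, biprod.inl_fst]
  set inlL := Hom.baseChange (AlgebraicClosure ℚ) (biprod.inl : B₁ ⟶ B₁ ⊞ B) with hinlL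
  set fstL := Hom.baseChange (AlgebraicClosure ℚ) (biprod.fst : B₁ ⊞ B ⟶ B₁) with hfstL
  set inrL := Hom.baseChange (AlgebraicClosure ℚ) (biprod.inr : B ⟶ B₁ ⊞ B) with hinrL
  set sndL := Hom.baseChange (AlgebraicClosure ℚ) (biprod.snd : B₁ ⊞ B ⟶ B) with hsndL
  have h_inl_fst : inlL ≫ fstL = 𝟙 _ := by
    rw [hinlL, hfstL, ← Hom.baseChange_comp, biprod.inl_fst, Hom.baseChange_id]
  have h_inr_snd : inrL ≫ sndL = 𝟙 _ := by
    rw [hinrL, hsndL, ← Hom.baseChange_comp, biprod.inr_snd, Hom.baseChange_id]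
  set I := Hom.baseChange (AlgebraicClosure ℚ) (biprod.fst ≫ i ≫ biprod.inr : B₁ ⊞ B ⟶ B₁ ⊞ B)
    with hIdef
  set ε := Hom.baseChange (AlgebraicClosure ℚ) (biprod.fst ≫ biprod.inl : B₁ ⊞ B ⟶ B₁ ⊞ B)
    with hεdef
  have hI : I = fstL ≫ iL ≫ inrL := by
    rw [hIdef, Hom.baseChange_comp, Hom.baseChange_comp]
  have hε : ε = fstL ≫ inlL := Hom.baseChange_comp (AlgebraicClosure ℚ) _ _
  have hIgal : ∀ σ : AlgebraicClosure ℚ ≃ₐ[ℚ] AlgebraicClosure ℚ,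
      (B₁ ⊞ B).galConj (AlgebraicClosure ℚ) σ I = I := fun σ => (B₁ ⊞ B).galConj_baseChange _ σ _
  have hεgal : ∀ σ : AlgebraicClosure ℚ ≃ₐ[ℚ] AlgebraicClosure ℚ,
      (B₁ ⊞ B).galConj (AlgebraicClosure ℚ) σ ε = ε := fun σ => (B₁ ⊞ B).galConj_baseChange _ σ _
  set Y : (B₁ ⊞ B).baseChange (AlgebraicClosure ℚ) ⟶ (B₁ ⊞ B).baseChange (AlgebraicClosure ℚ) :=
    sndL ≫ q' ≫ inlL with hY
  have hIY : I ≫ Y = m • ε := by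
    rw [hI, hY, hε]
    simp only [Category.assoc]
    rw [reassoc_of% h_inr_snd, reassoc_of% hq'i, Preadditive.nsmul_comp, Category.id_comp,
      Preadditive.comp_nsmul]
  have hstar : ∀ σ : AlgebraicClosure ℚ ≃ₐ[ℚ] AlgebraicClosure ℚ,
      I ≫ (B₁ ⊞ B).galConj (AlgebraicClosure ℚ) σ Y = m • ε := by
    intro σ
    let Φ := AddMonoidHom.mk' ((B₁ ⊞ B).galConj (AlgebraicClosure ℚ) σ)
      ((B₁ ⊞ B).galConj_add (AlgebraicClosure ℚ) σ)
    have h := congrArg Φ hIY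
    rw [map_nsmul] at h
    change (B₁ ⊞ B).galConj (AlgebraicClosure ℚ) σ (I ≫ Y) =
      m • (B₁ ⊞ B).galConj (AlgebraicClosure ℚ) σ ε at h
    rwa [(B₁ ⊞ B).galConj_comp (AlgebraicClosure ℚ) σ, hIgal, hεgal] at h
  have hfin := (B₁ ⊞ B).finite_range_toRingHom_galois (module_finite_hom_holds _ _)
    isTorsionFree_int_hom_of_charZero
  set ρ := MulSemiringAction.toRingHom (AlgebraicClosure ℚ ≃ₐ[ℚ] AlgebraicClosure ℚ)
    (End ((B₁ ⊞ B).baseChange (AlgebraicClosure ℚ))) with hρ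
  have hρmul : ∀ σ τ : AlgebraicClosure ℚ ≃ₐ[ℚ] AlgebraicClosure ℚ,
      (ρ σ).comp (ρ τ) = ρ (σ * τ) := fun σ τ => by
    ext x
    simp only [hρ, RingHom.coe_comp, Function.comp_apply, MulSemiringAction.toRingHom_apply,
      mul_smul]
  have hρinv : ∀ σ τ : AlgebraicClosure ℚ ≃ₐ[ℚ] AlgebraicClosure ℚ, σ * τ = 1 →
      ∀ t : End ((B₁ ⊞ B).baseChange (AlgebraicClosure ℚ)) →+*
        End ((B₁ ⊞ B).baseChange (AlgebraicClosure ℚ)), (ρ σ).comp ((ρ τ).comp t) = t := by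
    intro σ τ hστ t
    rw [← RingHom.comp_assoc, hρmul, hστ]
    ext x
    simp only [hρ, RingHom.coe_comp, Function.comp_apply, MulSemiringAction.toRingHom_apply,
      one_smul]
  set G := hfin.toFinset with hG
  have hGmem : ∀ t, t ∈ G ↔ ∃ σ, ρ σ = t := fun t => hfin.mem_toFinset
  have hGne : G.Nonempty := ⟨ρ 1, (hGmem _).2 ⟨1, rfl⟩⟩
  set U : (B₁ ⊞ B).baseChange (AlgebraicClosure ℚ) ⟶ (B₁ ⊞ B).baseChange (AlgebraicClosure ℚ) :=
    ∑ t ∈ G, End.asHom (t (End.of Y)) with hU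
  have hU_gal : ∀ σ : AlgebraicClosure ℚ ≃ₐ[ℚ] AlgebraicClosure ℚ,
      (B₁ ⊞ B).galConj (AlgebraicClosure ℚ) σ U = U := by
    intro σ
    let Φ := AddMonoidHom.mk' ((B₁ ⊞ B).galConj (AlgebraicClosure ℚ) σ)
      ((B₁ ⊞ B).galConj_add (AlgebraicClosure ℚ) σ)
    change Φ (∑ t ∈ G, End.asHom (t (End.of Y))) = _
    rw [map_sum]
    refine Finset.sum_nbij' (fun t => (ρ σ).comp t) (fun t => (ρ σ⁻¹).comp t) ?_ ?_ ?_ ?_ ?_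
    · intro t ht
      obtain ⟨τ, rfl⟩ := (hGmem t).1 ht
      exact (hGmem _).2 ⟨σ * τ, (hρmul σ τ).symm⟩
    · intro t ht
      obtain ⟨τ, rfl⟩ := (hGmem t).1 ht
      exact (hGmem _).2 ⟨σ⁻¹ * τ, (hρmul σ⁻¹ τ).symm⟩
    · exact fun t _ => hρinv _ _ (inv_mul_cancel σ) t
    · exact fun t _ => hρinv _ _ (mul_inv_cancel σ) t
    · exact fun t _ => rfl
  have hIU : I ≫ U = (G.card * m) • ε := by
    have hterm : ∀ t ∈ G, I ≫ End.asHom (t (End.of Y)) = m • ε := fun t ht => by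
      obtain ⟨τ, rfl⟩ := (hGmem t).1 ht
      exact hstar τ
    rw [hU, Preadditive.comp_sum, Finset.sum_congr rfl hterm, Finset.sum_const, smul_smul]
  obtain ⟨uP, huP⟩ :=
    (B₁ ⊞ B).exists_baseChange_eq_of_forall_galConj_eq (AlgebraicClosure ℚ) U hU_gal
  refine ⟨biprod.inr ≫ uP ≫ biprod.fst, G.card * m, Nat.mul_pos (Finset.card_pos.2 hGne) hm, ?_⟩
  have h1 : iL ≫ inrL ≫ U = (G.card * m) • inlL := by
    have h2 := congrArg (fun x => inlL ≫ x) hIU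
    simp only [hI, hε, Category.assoc, Preadditive.comp_nsmul] at h2
    rwa [reassoc_of% h_inl_fst, reassoc_of% h_inl_fst] at h2
  apply Hom.baseChange_injective (AlgebraicClosure ℚ)
  rw [Hom.baseChange_comp, Hom.baseChange_comp, Hom.baseChange_comp, huP, baseChange_nsmul,
    Hom.baseChange_id, ← hiL, ← hinrL, ← hfstL, reassoc_of% h1, Preadditive.nsmul_comp, h_inl_fst]

/-- **A complement from a quasi-retraction.** If `i : B₁ ↪ B` is a closed-immersion homomorphism
and `i ≫ q = M • 𝟙`, `M ≥ 1`, then for `v = M • 𝟙 − q ≫ i` (`i ≫ v = 0`, `v ≫ q = 0`, `v ≫ v = M • v`)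
and `j = (im v ↪ B)`, `(i, j) : B₁ ⊞ im v → B` is an isogeny: `(q, B ↠ im v)` is a two-sided
quasi-inverse up to `[M]` (both surjective, equal dimensions; Mumford §19, Thm. 1). -/
theorem exists_isIsogeny_desc_of_quasiRetraction {B₁ B : AbelianVariety.{0} ℚ} (i : B₁ ⟶ B)
    [IsClosedImmersion (AbelianVariety.Hom.toSchemeHom i)] (q : B ⟶ B₁) {M : ℕ} (hM : 0 < M)
    (hiq : i ≫ q = M • 𝟙 B₁) :
    ∃ (B₂ : AbelianVariety.{0} ℚ) (j : B₂ ⟶ B), AbelianVariety.IsIsogeny (biprod.desc i j) := by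
  obtain ⟨v, hv⟩ : ∃ v : B ⟶ B, v = M • 𝟙 B - q ≫ i := ⟨_, rfl⟩
  have hiv : i ≫ v = 0 := by
    rw [hv, Preadditive.comp_sub, Preadditive.comp_nsmul, Category.comp_id, reassoc_of% hiq,
      Preadditive.nsmul_comp, Category.id_comp, sub_self]
  have hvq : v ≫ q = 0 := by
    rw [hv, Preadditive.sub_comp, Preadditive.nsmul_comp, Category.id_comp, Category.assoc, hiq,
      Preadditive.comp_nsmul, Category.comp_id, sub_self]
  have hvv : v ≫ v = M • v := by
    have e1 : v ≫ v = v ≫ (M • 𝟙 B - q ≫ i) := by rw [← hv]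
    rw [e1, Preadditive.comp_sub, Preadditive.comp_nsmul, Category.comp_id, reassoc_of% hvq,
      zero_comp, sub_zero]
  have huv : q ≫ i + v = M • 𝟙 B := by rw [hv, add_sub_cancel]
  have m12 : i ≫ toImage v = 0 := by
    apply eq_of_comp_eq_of_isClosedImmersion (imageι v)
    rw [Category.assoc, toImage_imageι, zero_comp, hiv]
  have m21 : imageι v ≫ q = 0 := by
    apply eq_of_comp_eq_of_surjective (toImage v)
    rw [comp_zero, ← Category.assoc, toImage_imageι, hvq]
  have m22 : imageι v ≫ toImage v = M • 𝟙 (image v) := by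
    apply eq_of_comp_eq_of_surjective (toImage v)
    apply eq_of_comp_eq_of_isClosedImmersion (imageι v)
    simp only [Category.assoc, toImage_imageι, toImage_imageι_assoc, Preadditive.nsmul_comp,
      Preadditive.comp_nsmul, Category.id_comp]
    exact hvv
  refine ⟨image v, imageι v, ?_⟩
  have h1 : biprod.lift q (toImage v) ≫ biprod.desc i (imageι v) = M • 𝟙 B := by
    rw [biprod.lift_desc, toImage_imageι, huv]
  have h2 : biprod.desc i (imageι v) ≫ biprod.lift q (toImage v) = M • 𝟙 _ := by
    apply biprod.hom_ext' <;> apply biprod.hom_ext <;>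
      simp only [Category.assoc, biprod.lift_fst, biprod.lift_snd, biprod.inl_desc_assoc,
        biprod.inr_desc_assoc, hiq, m12, m21, m22, Preadditive.comp_nsmul,
        Preadditive.nsmul_comp, Category.comp_id, biprod.inl_fst,
        biprod.inl_snd, biprod.inr_fst, biprod.inr_snd, smul_zero]
  haveI : Surjective (Hom.toSchemeHom
      (biprod.lift q (toImage v) ≫ biprod.desc i (imageι v))) := by
    rw [h1]; exact surjective_nsmul_id B hM
  haveI : Surjective (Hom.toSchemeHom
      (biprod.desc i (imageι v) ≫ biprod.lift q (toImage v))) := by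
    rw [h2]; exact surjective_nsmul_id _ hM
  haveI hφ : Surjective (Hom.toSchemeHom (biprod.desc i (imageι v))) :=
    surjective_of_comp (biprod.lift q (toImage v)) _
  haveI hρ : Surjective (Hom.toSchemeHom (biprod.lift q (toImage v))) :=
    surjective_of_comp (biprod.desc i (imageι v)) _
  exact isIsogeny_of_surjective_of_dim_eq _ (le_antisymm
    (dim_le_of_surjective (biprod.lift q (toImage v)))
    (dim_le_of_surjective (biprod.desc i (imageι v))))

/-- **The power `E^r` (`r ≥ 1`) as an iterated binary biproduct** `E^{r+1} = E^r ⊞ E`, packaged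
by projections `π_a` and inclusions `ι_a` with `ι_a ≫ π_a = 𝟙`, `ι_a ≫ π_b = 0` (`a ≠ b`),
`Σ_a π_a ≫ ι_a = 𝟙`. -/
theorem exists_biprodPower (E : AbelianVariety.{0} ℚ) {r : ℕ} (hr : 1 ≤ r) :
    ∃ (P : AbelianVariety.{0} ℚ) (π : Fin r → (P ⟶ E)) (ι : Fin r → (E ⟶ P)),
      (∀ a, ι a ≫ π a = 𝟙 E) ∧ (∀ a b, a ≠ b → ι a ≫ π b = 0) ∧ ∑ a, π a ≫ ι a = 𝟙 P := by
  induction r, hr using Nat.le_induction with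
  | base =>
    refine ⟨E, fun _ => 𝟙 E, fun _ => 𝟙 E, fun a => Category.comp_id _,
      fun a b hab => (hab (Subsingleton.elim a b)).elim, ?_⟩
    rw [Fin.sum_univ_one, Category.comp_id]
  | succ r hr ih =>
    obtain ⟨P, π, ι, h1, h2, h3⟩ := ih
    refine ⟨P ⊞ E, Fin.snoc (α := fun _ => (P ⊞ E ⟶ E)) (fun a => biprod.fst ≫ π a) biprod.snd,
      Fin.snoc (α := fun _ => (E ⟶ P ⊞ E)) (fun a => ι a ≫ biprod.inl) biprod.inr, ?_, ?_, ?_⟩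
    · intro a
      induction a using Fin.lastCases with
      | last => simp only [Fin.snoc_last, biprod.inr_snd]
      | cast a => simp only [Fin.snoc_castSucc, Category.assoc, biprod.inl_fst_assoc, h1]
    · intro a b hab
      induction a using Fin.lastCases with
      | last =>
        induction b using Fin.lastCases with
        | last => exact (hab rfl).elim
        | cast b => simp only [Fin.snoc_last, Fin.snoc_castSucc, biprod.inr_fst_assoc, zero_comp]
      | cast a =>
        induction b using Fin.lastCases with
        | last =>
          simp only [Fin.snoc_last, Fin.snoc_castSucc, Category.assoc, biprod.inl_snd, comp_zero]
        | cast b =>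
          have hab' : a ≠ b := fun h => hab (by rw [h])
          simp only [Fin.snoc_castSucc, Category.assoc, biprod.inl_fst_assoc, h2 a b hab']
    · rw [Fin.sum_univ_castSucc]
      simp only [Fin.snoc_castSucc, Fin.snoc_last, Category.assoc]
      calc ∑ a : Fin r, biprod.fst ≫ π a ≫ ι a ≫ biprod.inl + biprod.snd ≫ biprod.inr
          = biprod.fst ≫ (∑ a, π a ≫ ι a) ≫ biprod.inl + biprod.snd ≫ biprod.inr := by
            rw [Preadditive.sum_comp, Preadditive.comp_sum]
            simp only [Category.assoc]
        _ = 𝟙 _ := by rw [h3, Category.id_comp, biprod.total]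

/-- **A non-zero `Γ_ℚ`-stable subgroup of `E[ℓ]` is all of `E[ℓ]`** when `W[ℓ]` is irreducible
(`W.HasIrreducibleModPGaloisRep ℓ`), transported along the equivariant `e : E(ℚ̄) ≃+ W(ℚ̄)` (the
image `H' ≤ W[ℓ]` of `H` is stable and `≠ ⊥`, hence `⊤`; cf. `geomTorsion_le_of_stable`). -/
theorem geomTorsion_le_of_stable_of_irreducible {W : WeierstrassCurve ℚ} [W.IsElliptic]
    {E : AbelianVariety.{0} ℚ} (e : E.geomPoints ≃+ W.geomPoints)
    (he : ∀ (σ : Field.absoluteGaloisGroup ℚ) (P : E.geomPoints), e (σ • P) = σ • e P)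
    {ℓ : ℕ} (hirr : W.HasIrreducibleModPGaloisRep ℓ) (H : AddSubgroup E.geomPoints)
    (hH : H ≤ E.geomTorsion ℓ)
    (hstab : ∀ (σ : Field.absoluteGaloisGroup ℚ) (P : E.geomPoints), P ∈ H → σ • P ∈ H)
    (hne : H ≠ ⊥) : E.geomTorsion ℓ ≤ H := by
  classical
  let H' : AddSubgroup (W.geomTorsion ℓ) :=
    (H.map e.toAddMonoidHom).comap (W.geomTorsion ℓ).subtype
  have hH'stab : ∀ (σ : Field.absoluteGaloisGroup ℚ) (Q : W.geomTorsion ℓ),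
      Q ∈ H' → σ • Q ∈ H' := by
    intro σ Q hQ
    simp only [H', AddSubgroup.mem_comap, AddSubgroup.coe_subtype, AddSubgroup.mem_map] at hQ ⊢
    obtain ⟨P, hP, hPQ⟩ := hQ
    refine ⟨σ • P, hstab σ P hP, ?_⟩
    change e (σ • P) = ((σ • Q : W.geomTorsion ℓ) : W.geomPoints)
    rw [he, Literature.NumberTheory.EllipticCurves.AddSubgroup.torsionBy.coe_smul]
    exact congrArg (σ • ·) hPQ
  rcases hirr H' hH'stab with h | h
  · exfalso
    apply hne
    rw [eq_bot_iff]
    intro P hP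
    have hPt : e P ∈ W.geomTorsion ℓ := (map_mem_geomTorsion_iff e ℓ P).2 (hH hP)
    have hmem : (⟨e P, hPt⟩ : W.geomTorsion ℓ) ∈ H' := by
      simp only [H', AddSubgroup.mem_comap, AddSubgroup.coe_subtype, AddSubgroup.mem_map]
      exact ⟨P, hP, rfl⟩
    rw [h, AddSubgroup.mem_bot] at hmem
    have : e P = 0 := congrArg Subtype.val hmem
    rw [AddSubgroup.mem_bot]
    exact e.map_eq_zero_iff.1 this
  · intro P hP
    have hPt : e P ∈ W.geomTorsion ℓ := (map_mem_geomTorsion_iff e ℓ P).2 hP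
    have hmem : (⟨e P, hPt⟩ : W.geomTorsion ℓ) ∈ H' := by rw [h]; trivial
    simp only [H', AddSubgroup.mem_comap, AddSubgroup.coe_subtype, AddSubgroup.mem_map] at hmem
    obtain ⟨P', hP', hPP'⟩ := hmem
    rwa [← e.injective hPP']

/-- **Stable subgroups of `V^r`, `V` irreducible with scalar commutant**: every non-zero stable
`D ≤ V^r` contains a line `{(n_j • P)_j : P ∈ V}` with `n_i` acting as the identity for some `i`
(a minimal non-zero stable `D' ≤ D` projects isomorphically onto some coordinate — onto by
irreducibility, into by minimality — and the inverse followed by the other projections are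
equivariant endomorphisms, i.e. integer scalars). -/
theorem exists_smul_line_le_of_stable' {Γ V : Type*} [Monoid Γ] [AddCommGroup V]
    [DistribMulAction Γ V] [Finite V]
    (hirr : ∀ H : AddSubgroup V, (∀ (σ : Γ) (P : V), P ∈ H → σ • P ∈ H) → H = ⊥ ∨ H = ⊤)
    (hsc : ∀ f : V →+ V, (∀ (σ : Γ) (P : V), f (σ • P) = σ • f P) → ∃ n : ℤ, ∀ P, f P = n • P)
    {r : ℕ} (D : AddSubgroup (Fin r → V))
    (hD : ∀ (σ : Γ) (x : Fin r → V), x ∈ D → σ • x ∈ D) (hD0 : D ≠ ⊥) :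
    ∃ (n : Fin r → ℤ) (i : Fin r), (∀ P : V, n i • P = P) ∧ ∀ P : V, (fun j ↦ n j • P) ∈ D := by
  classical
  haveI : Finite (AddSubgroup (Fin r → V)) :=
    Finite.of_injective (fun H : AddSubgroup (Fin r → V) ↦ (H : Set (Fin r → V)))
      SetLike.coe_injective
  obtain ⟨D', ⟨hD'D, hD'st, hD'0⟩, hmin⟩ :=
    Set.exists_min_image
      {D' : AddSubgroup (Fin r → V) |
        D' ≤ D ∧ (∀ (σ : Γ) (x : Fin r → V), x ∈ D' → σ • x ∈ D') ∧ D' ≠ ⊥}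
      (fun H ↦ Nat.card H) (Set.toFinite _) ⟨D, le_rfl, hD, hD0⟩
  have hmin' : ∀ D'' : AddSubgroup (Fin r → V), D'' ≤ D' →
      (∀ (σ : Γ) (x : Fin r → V), x ∈ D'' → σ • x ∈ D'') → D'' = ⊥ ∨ D'' = D' := by
    intro D'' hle hst
    by_cases h0 : D'' = ⊥
    · exact Or.inl h0
    · exact Or.inr (AddSubgroup.eq_of_le_of_card_ge hle (hmin D'' ⟨hle.trans hD'D, hst, h0⟩))
  obtain ⟨x, hxD', hx0⟩ : ∃ x ∈ D', x ≠ 0 := by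
    by_contra h
    push Not at h
    exact hD'0 ((AddSubgroup.eq_bot_iff_forall _).2 h)
  obtain ⟨i, hi⟩ : ∃ i, x i ≠ 0 := by
    by_contra h
    push Not at h
    exact hx0 (funext h)
  let πi : D' →+ V := (Pi.evalAddMonoidHom (fun _ : Fin r ↦ V) i).comp D'.subtype
  have hπi : ∀ y : D', πi y = (y : Fin r → V) i := fun y ↦ rfl
  have hsurj : Function.Surjective πi := by
    have hst : ∀ (σ : Γ) (P : V), P ∈ πi.range → σ • P ∈ πi.range := by
      rintro σ P ⟨y, rfl⟩
      exact ⟨⟨σ • (y : Fin r → V), hD'st σ y y.2⟩, rfl⟩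
    rcases hirr πi.range hst with h | h
    · exfalso
      apply hi
      have hx : πi ⟨x, hxD'⟩ ∈ πi.range := ⟨_, rfl⟩
      rw [h, AddSubgroup.mem_bot] at hx
      exact hx
    · exact AddMonoidHom.range_eq_top.1 h
  have hinj : Function.Injective πi := by
    let K : AddSubgroup (Fin r → V) := D' ⊓ (Pi.evalAddMonoidHom (fun _ : Fin r ↦ V) i).ker
    have hKst : ∀ (σ : Γ) (y : Fin r → V), y ∈ K → σ • y ∈ K := by
      intro σ y hy
      obtain ⟨hy1, hy2⟩ := AddSubgroup.mem_inf.1 hy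
      refine AddSubgroup.mem_inf.2 ⟨hD'st σ y hy1, ?_⟩
      rw [AddMonoidHom.mem_ker] at hy2 ⊢
      change σ • y i = 0
      rw [show y i = 0 from hy2, smul_zero]
    rcases hmin' K inf_le_left hKst with h | h
    · intro y z hyz
      have hmem : (y : Fin r → V) - z ∈ K := by
        refine AddSubgroup.mem_inf.2 ⟨D'.sub_mem y.2 z.2, ?_⟩
        rw [AddMonoidHom.mem_ker, map_sub]
        change (y : Fin r → V) i - (z : Fin r → V) i = 0
        rw [← hπi, ← hπi, hyz, sub_self]
      rw [h, AddSubgroup.mem_bot, sub_eq_zero] at hmem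
      exact Subtype.ext hmem
    · exfalso
      apply hi
      have hxK : x ∈ K := by rw [h]; exact hxD'
      exact AddMonoidHom.mem_ker.1 (AddSubgroup.mem_inf.1 hxK).2
  let e : D' ≃+ V := AddEquiv.ofBijective πi ⟨hinj, hsurj⟩
  let ψ : V →+ (Fin r → V) := D'.subtype.comp e.symm.toAddMonoidHom
  have hψi : ∀ P, ψ P i = P := fun P ↦ by
    change πi (e.symm P) = P
    exact e.apply_symm_apply P
  have hψD' : ∀ P, ψ P ∈ D' := fun P ↦ (e.symm P).2
  have hψeq : ∀ (σ : Γ) (P : V), ψ (σ • P) = σ • ψ P := by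
    intro σ P
    have h1 : σ • ψ P ∈ D' := hD'st σ _ (hψD' P)
    have h2 := @hinj (e.symm (σ • P)) ⟨σ • ψ P, h1⟩ (by
      rw [hπi, hπi]
      change ψ (σ • P) i = (σ • ψ P) i
      rw [hψi, Pi.smul_apply, hψi])
    exact congrArg Subtype.val h2
  have hcoord : ∀ j : Fin r, ∃ n : ℤ, ∀ P : V, ψ P j = n • P := fun j ↦
    hsc ((Pi.evalAddMonoidHom (fun _ : Fin r ↦ V) j).comp ψ) (fun σ P ↦ by
      change ψ (σ • P) j = σ • ψ P j
      rw [hψeq, Pi.smul_apply])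
  choose n hn using hcoord
  refine ⟨n, i, fun P ↦ by rw [← hn i P, hψi], fun P ↦ ?_⟩
  rw [show (fun j ↦ n j • P) = ψ P from funext fun j ↦ (hn j P).symm]
  exact hD'D (hψD' P)

end Summit.ABC.ABC.Theorems.IsotypicMinkowski

end
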